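import Summits.CriticalPhenomena.PercolationContinuityZ3.Theorems.PercNearOneGluingNoHeavyLowerTailKnQuestion8CoefficientwiseCoreClassKernelMixBoundaryPrefix
import HarnessLib

/-!
# Boundary inequality on bundles, III: the two prefix-frozen fibre systems (THEOREM BI, abstract form)

Support file (`--supports stmt-CriticalPhenomena-4575`, closed), prover `prim-cplus-coupling` (gen 46).  No definitions, no notations, no named facts,
no sorries; standard axioms.  Memo `prim-cplus-coupling/A5-COUPLING-gen45.md` §3.9 (THEOREM BI), steps (a)–(d) minus the cluster traces.

ABSTRACT SETTING.  Two disjoint threads `P = {eP 1..eP ℓ}`, `Q = {eQ 1..eQ m}`; colourings `ξ ⊆ P ∪ Q` (the red edges of the two mixed threads; the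
remaining threads of the bundle are blue at sources and red at targets and do not appear here).  Status predicates `Vp` (the event), `hro, kro`
(increasing), `hbo, kbo` (decreasing); `N ξ :⟺ ¬ P ⊆ ξ ∧ ¬ Q ⊆ ξ` (no full thread = demand region); SOURCES `src₁ = Vp ∧ N ∧ hro ∧ kbo`,
`src₂ = Vp ∧ N ∧ kro ∧ hbo`, JOINS `Vp ∧ N ∧ hro ∧ kro`; abstract TARGET predicates `T₁, T₂`.  The TRANSFER hypotheses say: a landing `ξ` of the
`(a, c)`-prefix-frozen flow (prefix `R^a B` frozen on `P` if `a ≥ 1`, `R^c B` on `Q` if `c ≥ 1`, Harris on the rest) with partner `ρ` — described edge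
by edge — is a target of its type (on a bundle: `…KernelMixBundleBoundaryTransfer`).  The CHAIN hypotheses say: the two types do not both have a
source that is blue-starting-or-empty on `P` (resp. on `Q`) (on a bundle: the chain lemma, memo §3.9 (b)).
* `Coefficientwise.boundary_systems_count` — for any admissible pair of fibre systems (each type freezes a subset of the threads on which all its
  sources start red, and each thread is frozen by at least one type) `#src₁ + #src₂ ≤ #(T₁ ∨ T₂) + #joins`;
* `Coefficientwise.boundary_prefix_flows_count` — THEOREM BI, abstract: the same conclusion from the transfer and chain hypotheses alone (the
  three-way assignment of memo §3.9 (c): `B₂ = ∅` ⟹ type 1 plain / type 2 double freeze; `B₁ = ∅` symmetric; else cross single freezes).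
[cite: KozmaNitzan2024, Questions 8–9 (§5.5 p. 36) (context); Harris 1960]
-/

namespace Summit.CriticalPhenomena.PercolationContinuityZ3.Theorems

open Finset

namespace Coefficientwise

variable {ι : Type*}

open Classical in
/-- **Two admissible prefix-frozen fibre systems.**  Setting of the module docstring.  Type 1 uses the fibres `(a, c) ∈ SP ×ˢ SQ`, type 2 the fibres
`(a, c) ∈ SP' ×ˢ SQ'`, where each of `SP, SP'` is `{0}` (thread `P` not frozen) or `[1, ℓ−1]` (thread `P` prefix-frozen) and likewise for `Q`; a type may
freeze a thread only if all its sources start red there (`cov`), and each thread is frozen by at least one type (`jP`, `jQ`: then common landings have no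
full thread, i.e. are joins).  Conclusion: `#src₁ + #src₂ ≤ #(T₁ ∨ T₂) + #joins` for the source / target / join families `S₁, S₂, TT, JJ` given by
their membership descriptions.  Memo gen 45 §3.9 (a), (c), (d).  [cite: KozmaNitzan2024, Questions 8–9 (§5.5 p. 36) (context); Harris 1960] -/
theorem boundary_systems_count (P Q : Finset ι) (hPQ : Disjoint P Q) (ℓ m : ℕ) (hℓ : 1 ≤ ℓ) (hm : 1 ≤ m) (eP eQ : ℕ → ι)
    (heP : ∀ j, 1 ≤ j → j ≤ ℓ → eP j ∈ P) (hePinj : ∀ i j, 1 ≤ i → i ≤ ℓ → 1 ≤ j → j ≤ ℓ → eP i = eP j → i = j)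
    (hPe : ∀ x ∈ P, ∃ j, 1 ≤ j ∧ j ≤ ℓ ∧ eP j = x)
    (heQ : ∀ j, 1 ≤ j → j ≤ m → eQ j ∈ Q) (heQinj : ∀ i j, 1 ≤ i → i ≤ m → 1 ≤ j → j ≤ m → eQ i = eQ j → i = j)
    (hQe : ∀ x ∈ Q, ∃ j, 1 ≤ j ∧ j ≤ m ∧ eQ j = x)
    (Vp hro kro hbo kbo T₁ T₂ : Finset ι → Prop)
    (V_mono : ∀ s t : Finset ι, s ⊆ t → Vp s → Vp t) (hro_mono : ∀ s t : Finset ι, s ⊆ t → hro s → hro t)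
    (kro_mono : ∀ s t : Finset ι, s ⊆ t → kro s → kro t)
    (hbo_anti : ∀ s t : Finset ι, s ⊆ t → hbo t → hbo s) (kbo_anti : ∀ s t : Finset ι, s ⊆ t → kbo t → kbo s)
    (transfer₁ : ∀ a c : ℕ, a < ℓ → c < m → ∀ ξ ρ : Finset ι, ξ ⊆ P ∪ Q → ρ ⊆ P ∪ Q →
      (∀ j, 1 ≤ j → j ≤ a → eP j ∈ ξ ∧ eP j ∈ ρ) → (1 ≤ a → eP (a + 1) ∉ ξ ∧ eP (a + 1) ∉ ρ) →
      (∀ j, 1 ≤ j → j ≤ ℓ → (a = 0 ∨ a + 2 ≤ j) → (eP j ∈ ρ ↔ eP j ∉ ξ)) →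
      (∀ j, 1 ≤ j → j ≤ c → eQ j ∈ ξ ∧ eQ j ∈ ρ) → (1 ≤ c → eQ (c + 1) ∉ ξ ∧ eQ (c + 1) ∉ ρ) →
      (∀ j, 1 ≤ j → j ≤ m → (c = 0 ∨ c + 2 ≤ j) → (eQ j ∈ ρ ↔ eQ j ∉ ξ)) →
      Vp ξ → hro ξ → kbo ρ → ¬ P ⊆ ρ → ¬ Q ⊆ ρ → T₁ ξ)
    (transfer₂ : ∀ a c : ℕ, a < ℓ → c < m → ∀ ξ ρ : Finset ι, ξ ⊆ P ∪ Q → ρ ⊆ P ∪ Q →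
      (∀ j, 1 ≤ j → j ≤ a → eP j ∈ ξ ∧ eP j ∈ ρ) → (1 ≤ a → eP (a + 1) ∉ ξ ∧ eP (a + 1) ∉ ρ) →
      (∀ j, 1 ≤ j → j ≤ ℓ → (a = 0 ∨ a + 2 ≤ j) → (eP j ∈ ρ ↔ eP j ∉ ξ)) →
      (∀ j, 1 ≤ j → j ≤ c → eQ j ∈ ξ ∧ eQ j ∈ ρ) → (1 ≤ c → eQ (c + 1) ∉ ξ ∧ eQ (c + 1) ∉ ρ) →
      (∀ j, 1 ≤ j → j ≤ m → (c = 0 ∨ c + 2 ≤ j) → (eQ j ∈ ρ ↔ eQ j ∉ ξ)) →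
      Vp ξ → kro ξ → hbo ρ → ¬ P ⊆ ρ → ¬ Q ⊆ ρ → T₂ ξ)
    (SP SQ SP' SQ' : Finset ℕ)
    (hSP : SP = {0} ∨ SP = Finset.Icc 1 (ℓ - 1)) (hSQ : SQ = {0} ∨ SQ = Finset.Icc 1 (m - 1))
    (hSP' : SP' = {0} ∨ SP' = Finset.Icc 1 (ℓ - 1)) (hSQ' : SQ' = {0} ∨ SQ' = Finset.Icc 1 (m - 1))
    (cov₁P : SP = Finset.Icc 1 (ℓ - 1) → ∀ σ, σ ⊆ P ∪ Q → (Vp σ ∧ (¬ P ⊆ σ ∧ ¬ Q ⊆ σ) ∧ hro σ ∧ kbo σ) → eP 1 ∈ σ)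
    (cov₁Q : SQ = Finset.Icc 1 (m - 1) → ∀ σ, σ ⊆ P ∪ Q → (Vp σ ∧ (¬ P ⊆ σ ∧ ¬ Q ⊆ σ) ∧ hro σ ∧ kbo σ) → eQ 1 ∈ σ)
    (cov₂P : SP' = Finset.Icc 1 (ℓ - 1) → ∀ σ, σ ⊆ P ∪ Q → (Vp σ ∧ (¬ P ⊆ σ ∧ ¬ Q ⊆ σ) ∧ kro σ ∧ hbo σ) → eP 1 ∈ σ)
    (cov₂Q : SQ' = Finset.Icc 1 (m - 1) → ∀ σ, σ ⊆ P ∪ Q → (Vp σ ∧ (¬ P ⊆ σ ∧ ¬ Q ⊆ σ) ∧ kro σ ∧ hbo σ) → eQ 1 ∈ σ)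
    (jP : SP = Finset.Icc 1 (ℓ - 1) ∨ SP' = Finset.Icc 1 (ℓ - 1)) (jQ : SQ = Finset.Icc 1 (m - 1) ∨ SQ' = Finset.Icc 1 (m - 1))
    (S₁ S₂ TT JJ : Finset (Finset ι))
    (hS₁ : ∀ ξ, ξ ∈ S₁ ↔ ξ ⊆ P ∪ Q ∧ (Vp ξ ∧ (¬ P ⊆ ξ ∧ ¬ Q ⊆ ξ) ∧ hro ξ ∧ kbo ξ))
    (hS₂ : ∀ ξ, ξ ∈ S₂ ↔ ξ ⊆ P ∪ Q ∧ (Vp ξ ∧ (¬ P ⊆ ξ ∧ ¬ Q ⊆ ξ) ∧ kro ξ ∧ hbo ξ))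
    (hTT : ∀ ξ, ξ ∈ TT ↔ ξ ⊆ P ∪ Q ∧ (T₁ ξ ∨ T₂ ξ))
    (hJJ : ∀ ξ, ξ ∈ JJ ↔ ξ ⊆ P ∪ Q ∧ (Vp ξ ∧ (¬ P ⊆ ξ ∧ ¬ Q ⊆ ξ) ∧ hro ξ ∧ kro ξ)) :
    S₁.card + S₂.card ≤ TT.card + JJ.card := by
  set E' : Finset ι := P ∪ Q with hE'
  have hPE : P ⊆ E' := Finset.subset_union_left
  have hQE : Q ⊆ E' := Finset.subset_union_right
  obtain ⟨preP, hpreP⟩ : ∃ f : ℕ → Finset ι, ∀ a x, x ∈ f a ↔ ∃ j, 1 ≤ j ∧ j ≤ a ∧ eP j = x :=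
    ⟨fun a => (Finset.Icc 1 a).image eP, fun a x => by
      simp only [Finset.mem_image, Finset.mem_Icc]
      constructor
      · rintro ⟨j, ⟨h1, h2⟩, h3⟩; exact ⟨j, h1, h2, h3⟩
      · rintro ⟨j, h1, h2, h3⟩; exact ⟨j, ⟨h1, h2⟩, h3⟩⟩
  obtain ⟨preQ, hpreQ⟩ : ∃ f : ℕ → Finset ι, ∀ a x, x ∈ f a ↔ ∃ j, 1 ≤ j ∧ j ≤ a ∧ eQ j = x :=
    ⟨fun a => (Finset.Icc 1 a).image eQ, fun a x => by
      simp only [Finset.mem_image, Finset.mem_Icc]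
      constructor
      · rintro ⟨j, ⟨h1, h2⟩, h3⟩; exact ⟨j, h1, h2, h3⟩
      · rintro ⟨j, h1, h2, h3⟩; exact ⟨j, ⟨h1, h2⟩, h3⟩⟩
  obtain ⟨ΦP, hΦP⟩ : ∃ f : ℕ → Finset ι, f = fun a => if a = 0 then ∅ else preP (a + 1) := ⟨_, rfl⟩
  obtain ⟨ΦQ, hΦQ⟩ : ∃ f : ℕ → Finset ι, f = fun a => if a = 0 then ∅ else preQ (a + 1) := ⟨_, rfl⟩
  have preP0 : preP 0 = ∅ := Finset.eq_empty_of_forall_notMem fun x hx => by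
    obtain ⟨j, h1, h2, _⟩ := (hpreP 0 x).mp hx; omega
  have preQ0 : preQ 0 = ∅ := Finset.eq_empty_of_forall_notMem fun x hx => by
    obtain ⟨j, h1, h2, _⟩ := (hpreQ 0 x).mp hx; omega
  have preP_sub : ∀ a, a ≤ ℓ → preP a ⊆ P := fun a ha x hx => by
    obtain ⟨j, h1, h2, rfl⟩ := (hpreP a x).mp hx; exact heP j h1 (by omega)
  have preQ_sub : ∀ a, a ≤ m → preQ a ⊆ Q := fun a ha x hx => by
    obtain ⟨j, h1, h2, rfl⟩ := (hpreQ a x).mp hx; exact heQ j h1 (by omega)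
  have preP_mono : ∀ a, preP a ⊆ preP (a + 1) := fun a x hx => by
    obtain ⟨j, h1, h2, rfl⟩ := (hpreP a _).mp hx; exact (hpreP _ _).mpr ⟨j, h1, by omega, rfl⟩
  have preQ_mono : ∀ a, preQ a ⊆ preQ (a + 1) := fun a x hx => by
    obtain ⟨j, h1, h2, rfl⟩ := (hpreQ a _).mp hx; exact (hpreQ _ _).mpr ⟨j, h1, by omega, rfl⟩
  have ΦP_cases : ∀ a, (a = 0 ∧ ΦP a = ∅) ∨ (1 ≤ a ∧ ΦP a = preP (a + 1)) := by
    intro a; rw [hΦP]; by_cases h : a = 0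
    · exact Or.inl ⟨h, by simp [h]⟩
    · exact Or.inr ⟨Nat.one_le_iff_ne_zero.mpr h, by simp [h]⟩
  have ΦQ_cases : ∀ c, (c = 0 ∧ ΦQ c = ∅) ∨ (1 ≤ c ∧ ΦQ c = preQ (c + 1)) := by
    intro c; rw [hΦQ]; by_cases h : c = 0
    · exact Or.inl ⟨h, by simp [h]⟩
    · exact Or.inr ⟨Nat.one_le_iff_ne_zero.mpr h, by simp [h]⟩
  have ΦP_sub : ∀ a, a < ℓ → preP a ⊆ ΦP a ∧ ΦP a ⊆ P := by
    intro a ha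
    rcases ΦP_cases a with ⟨h0, hF⟩ | ⟨_, hF⟩
    · rw [hF, h0, preP0]; exact ⟨le_refl _, Finset.empty_subset _⟩
    · rw [hF]; exact ⟨preP_mono a, preP_sub (a + 1) (by omega)⟩
  have ΦQ_sub : ∀ c, c < m → preQ c ⊆ ΦQ c ∧ ΦQ c ⊆ Q := by
    intro c hc
    rcases ΦQ_cases c with ⟨h0, hF⟩ | ⟨_, hF⟩
    · rw [hF, h0, preQ0]; exact ⟨le_refl _, Finset.empty_subset _⟩
    · rw [hF]; exact ⟨preQ_mono c, preQ_sub (c + 1) (by omega)⟩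
  have ΦP_pos : ∀ a, 1 ≤ a → ΦP a = preP (a + 1) := by
    intro a ha; rcases ΦP_cases a with ⟨h0, _⟩ | ⟨_, hF⟩
    · omega
    · exact hF
  have ΦQ_pos : ∀ c, 1 ≤ c → ΦQ c = preQ (c + 1) := by
    intro c hc; rcases ΦQ_cases c with ⟨h0, _⟩ | ⟨_, hF⟩
    · omega
    · exact hF
  have ΦP_zero : ∀ ξ : Finset ι, ξ ∩ ΦP 0 = preP 0 := by
    intro ξ; rcases ΦP_cases 0 with ⟨_, hF⟩ | ⟨h1, _⟩
    · rw [hF, preP0, Finset.inter_empty]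
    · omega
  have ΦQ_zero : ∀ ξ : Finset ι, ξ ∩ ΦQ 0 = preQ 0 := by
    intro ξ; rcases ΦQ_cases 0 with ⟨_, hF⟩ | ⟨h1, _⟩
    · rw [hF, preQ0, Finset.inter_empty]
    · omega
  obtain ⟨N, hN⟩ : ∃ f : Finset ι → Prop, f = fun ξ => ¬ P ⊆ ξ ∧ ¬ Q ⊆ ξ := ⟨_, rfl⟩
  have N_anti : ∀ s t : Finset ι, s ⊆ t → N t → N s := by
    intro s t hst ht; rw [hN] at ht ⊢; exact ⟨fun h => ht.1 (h.trans hst), fun h => ht.2 (h.trans hst)⟩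
  obtain ⟨src₁, hsrc₁⟩ : ∃ f : Finset ι → Prop, f = fun ξ => Vp ξ ∧ N ξ ∧ hro ξ ∧ kbo ξ := ⟨_, rfl⟩
  obtain ⟨src₂, hsrc₂⟩ : ∃ f : Finset ι → Prop, f = fun ξ => Vp ξ ∧ N ξ ∧ kro ξ ∧ hbo ξ := ⟨_, rfl⟩
  obtain ⟨Jn, hJn⟩ : ∃ f : Finset ι → Prop, f = fun ξ => Vp ξ ∧ N ξ ∧ hro ξ ∧ kro ξ := ⟨_, rfl⟩
  obtain ⟨fib, hfibd⟩ : ∃ f : ℕ × ℕ → Finset ι → Prop, f = fun j ξ => ξ ∩ ΦP j.1 = preP j.1 ∧ ξ ∩ ΦQ j.2 = preQ j.2 := ⟨_, rfl⟩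
  obtain ⟨ρ, hρ⟩ : ∃ f : ℕ × ℕ → Finset ι → Finset ι,
      f = fun j ξ => (preP j.1 ∪ preQ j.2) ∪ ((E' \ (ΦP j.1 ∪ ΦQ j.2)) \ ξ) := ⟨_, rfl⟩
  obtain ⟨land₁, hland₁⟩ : ∃ f : ℕ × ℕ → Finset ι → Prop, f = fun j ξ => Vp ξ ∧ hro ξ ∧ kbo (ρ j ξ) ∧ N (ρ j ξ) := ⟨_, rfl⟩
  obtain ⟨land₂, hland₂⟩ : ∃ f : ℕ × ℕ → Finset ι → Prop, f = fun j ξ => Vp ξ ∧ kro ξ ∧ hbo (ρ j ξ) ∧ N (ρ j ξ) := ⟨_, rfl⟩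
  -- ## the per-fibre flows
  have fib_iff : ∀ a c, a < ℓ → c < m → ∀ ξ : Finset ι, fib (a, c) ξ ↔ ξ ∩ (ΦP a ∪ ΦQ c) = preP a ∪ preQ c := by
    intro a c ha hc ξ
    rw [hfibd]
    exact prefix_fibre_inter_iff P Q (ΦP a) (preP a) (ΦQ c) (preQ c) ξ hPQ (ΦP_sub a ha).1 (ΦP_sub a ha).2 (ΦQ_sub c hc).1 (ΦQ_sub c hc).2
  have flow : ∀ a c, a < ℓ → c < m →
      (((E'.powerset).filter (fun ξ => fib (a, c) ξ ∧ src₁ ξ)).card ≤ ((E'.powerset).filter (fun ξ => fib (a, c) ξ ∧ land₁ (a, c) ξ)).card) ∧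
      (((E'.powerset).filter (fun ξ => fib (a, c) ξ ∧ src₂ ξ)).card ≤ ((E'.powerset).filter (fun ξ => fib (a, c) ξ ∧ land₂ (a, c) ξ)).card) := by
    intro a c ha hc
    have hπΦ : preP a ∪ preQ c ⊆ ΦP a ∪ ΦQ c := Finset.union_subset_union (ΦP_sub a ha).1 (ΦQ_sub c hc).1
    have hΦE : ΦP a ∪ ΦQ c ⊆ E' := Finset.union_subset ((ΦP_sub a ha).2.trans hPE) ((ΦQ_sub c hc).2.trans hQE)
    have k₁ := frozen_fibre_flow E' (ΦP a ∪ ΦQ c) (preP a ∪ preQ c) hπΦ hΦE Vp hro kbo N V_mono hro_mono kbo_anti N_anti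
    have k₂ := frozen_fibre_flow E' (ΦP a ∪ ΦQ c) (preP a ∪ preQ c) hπΦ hΦE Vp kro hbo N V_mono kro_mono hbo_anti N_anti
    have c1 : (E'.powerset).filter (fun ξ => fib (a, c) ξ ∧ src₁ ξ) =
        (E'.powerset).filter (fun ξ => ξ ∩ (ΦP a ∪ ΦQ c) = preP a ∪ preQ c ∧ (Vp ξ ∧ N ξ ∧ hro ξ ∧ kbo ξ)) :=
      Finset.filter_congr fun ξ _ => by rw [fib_iff a c ha hc ξ, hsrc₁]
    have c2 : (E'.powerset).filter (fun ξ => fib (a, c) ξ ∧ land₁ (a, c) ξ) =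
        (E'.powerset).filter (fun ξ => ξ ∩ (ΦP a ∪ ΦQ c) = preP a ∪ preQ c ∧
          (Vp ξ ∧ hro ξ ∧ kbo (preP a ∪ preQ c ∪ ((E' \ (ΦP a ∪ ΦQ c)) \ ξ)) ∧ N (preP a ∪ preQ c ∪ ((E' \ (ΦP a ∪ ΦQ c)) \ ξ)))) :=
      Finset.filter_congr fun ξ _ => by rw [fib_iff a c ha hc ξ, hland₁, hρ]
    have c3 : (E'.powerset).filter (fun ξ => fib (a, c) ξ ∧ src₂ ξ) =
        (E'.powerset).filter (fun ξ => ξ ∩ (ΦP a ∪ ΦQ c) = preP a ∪ preQ c ∧ (Vp ξ ∧ N ξ ∧ kro ξ ∧ hbo ξ)) :=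
      Finset.filter_congr fun ξ _ => by rw [fib_iff a c ha hc ξ, hsrc₂]
    have c4 : (E'.powerset).filter (fun ξ => fib (a, c) ξ ∧ land₂ (a, c) ξ) =
        (E'.powerset).filter (fun ξ => ξ ∩ (ΦP a ∪ ΦQ c) = preP a ∪ preQ c ∧
          (Vp ξ ∧ kro ξ ∧ hbo (preP a ∪ preQ c ∪ ((E' \ (ΦP a ∪ ΦQ c)) \ ξ)) ∧ N (preP a ∪ preQ c ∪ ((E' \ (ΦP a ∪ ΦQ c)) \ ξ)))) :=
      Finset.filter_congr fun ξ _ => by rw [fib_iff a c ha hc ξ, hland₂, hρ]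
    rw [c1, c2, c3, c4]
    exact ⟨k₁, k₂⟩
  -- ## edge-by-edge description of a fibre point and its partner
  have partner : ∀ a c, a < ℓ → c < m → ∀ ξ : Finset ι, fib (a, c) ξ →
      ρ (a, c) ξ ⊆ E' ∧
      (∀ j, 1 ≤ j → j ≤ a → eP j ∈ ξ ∧ eP j ∈ ρ (a, c) ξ) ∧ (1 ≤ a → eP (a + 1) ∉ ξ ∧ eP (a + 1) ∉ ρ (a, c) ξ) ∧
      (∀ j, 1 ≤ j → j ≤ ℓ → (a = 0 ∨ a + 2 ≤ j) → (eP j ∈ ρ (a, c) ξ ↔ eP j ∉ ξ)) ∧ (1 ≤ a → ¬ P ⊆ ξ) ∧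
      (∀ j, 1 ≤ j → j ≤ c → eQ j ∈ ξ ∧ eQ j ∈ ρ (a, c) ξ) ∧ (1 ≤ c → eQ (c + 1) ∉ ξ ∧ eQ (c + 1) ∉ ρ (a, c) ξ) ∧
      (∀ j, 1 ≤ j → j ≤ m → (c = 0 ∨ c + 2 ≤ j) → (eQ j ∈ ρ (a, c) ξ ↔ eQ j ∉ ξ)) ∧ (1 ≤ c → ¬ Q ⊆ ξ) := by
    intro a c ha hc ξ hfib
    rw [hfibd] at hfib
    obtain ⟨hfP, hfQ⟩ := hfib
    have hρE : ρ (a, c) ξ ⊆ E' := by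
      rw [hρ]
      exact Finset.union_subset (Finset.union_subset ((preP_sub a (le_of_lt ha)).trans hPE) ((preQ_sub c (le_of_lt hc)).trans hQE))
        (Finset.sdiff_subset.trans Finset.sdiff_subset)
    have hP' := prefix_partner_mem eP ℓ P E' (ΦP a ∪ ΦQ c) (preP a ∪ preQ c) (ΦQ c) (preQ c) hePinj heP hPE
      (Finset.disjoint_of_subset_left (ΦQ_sub c hc).2 hPQ.symm) (ΦQ_sub c hc).1 preP hpreP a ha (ΦP a) (ΦP_cases a) rfl rfl ξ hfP
    have hQ' := prefix_partner_mem eQ m Q E' (ΦP a ∪ ΦQ c) (preP a ∪ preQ c) (ΦP a) (preP a) heQinj heQ hQE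
      (Finset.disjoint_of_subset_left (ΦP_sub a ha).2 hPQ) (ΦP_sub a ha).1 preQ hpreQ c hc (ΦQ c) (ΦQ_cases c)
      (Finset.union_comm _ _) (Finset.union_comm _ _) ξ hfQ
    have hρ' : ρ (a, c) ξ = preP a ∪ preQ c ∪ ((E' \ (ΦP a ∪ ΦQ c)) \ ξ) := by rw [hρ]
    rw [hρ']
    exact ⟨hρ' ▸ hρE, hP'.1, hP'.2.1, hP'.2.2.1, hP'.2.2.2, hQ'.1, hQ'.2.1, hQ'.2.2.1, hQ'.2.2.2⟩
  have memS : ∀ (S : Finset ℕ) (n : ℕ), 1 ≤ n → (S = {0} ∨ S = Finset.Icc 1 (n - 1)) → ∀ a ∈ S, a < n := by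
    intro S n hn hS a ha
    rcases hS with hS | hS
    · rw [hS, Finset.mem_singleton] at ha; omega
    · rw [hS, Finset.mem_Icc] at ha; omega
  have memS2 : ∀ (S : Finset ℕ) (n : ℕ), (S = {0} ∨ S = Finset.Icc 1 (n - 1)) → ∀ a ∈ S, ∀ a' ∈ S, a ≠ a' → 1 ≤ a ∧ 1 ≤ a' := by
    intro S n hS a ha a' ha' hne
    rcases hS with hS | hS
    · rw [hS, Finset.mem_singleton] at ha ha'; omega
    · rw [hS, Finset.mem_Icc] at ha ha'; exact ⟨ha.1, ha'.1⟩
  have memIcc : ∀ (S : Finset ℕ) (n : ℕ), S = Finset.Icc 1 (n - 1) → ∀ a ∈ S, 1 ≤ a := by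
    intro S n hS a ha; rw [hS, Finset.mem_Icc] at ha; exact ha.1
  -- ## generic system facts: disjointness and cover
  have disj : ∀ (SP₀ SQ₀ : Finset ℕ), (SP₀ = {0} ∨ SP₀ = Finset.Icc 1 (ℓ - 1)) → (SQ₀ = {0} ∨ SQ₀ = Finset.Icc 1 (m - 1)) →
      ∀ j ∈ SP₀ ×ˢ SQ₀, ∀ j' ∈ SP₀ ×ˢ SQ₀, j ≠ j' → ∀ ξ, fib j ξ → fib j' ξ → False := by
    intro SP₀ SQ₀ hSP₀ hSQ₀ j hj j' hj' hne ξ h1 h2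
    obtain ⟨a, c⟩ := j
    obtain ⟨a', c'⟩ := j'
    rw [Finset.mem_product] at hj hj'
    simp only at hj hj'
    rw [hfibd] at h1 h2
    simp only at h1 h2
    have ha := memS SP₀ ℓ hℓ hSP₀ a hj.1
    have ha' := memS SP₀ ℓ hℓ hSP₀ a' hj'.1
    have hc := memS SQ₀ m hm hSQ₀ c hj.2
    have hc' := memS SQ₀ m hm hSQ₀ c' hj'.2
    by_cases haa : a = a'
    · have hcc : c ≠ c' := by intro hcc; exact hne (by rw [haa, hcc])
      obtain ⟨h1c, h1c'⟩ := memS2 SQ₀ m hSQ₀ c hj.2 c' hj'.2 hcc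
      have e1 := h1.2; have e2 := h2.2
      rw [ΦQ_pos c h1c] at e1; rw [ΦQ_pos c' h1c'] at e2
      exact prefix_fibre_disjoint eQ m heQinj preQ hpreQ c c' h1c h1c' hc hc' hcc ξ e1 e2
    · obtain ⟨h1a, h1a'⟩ := memS2 SP₀ ℓ hSP₀ a hj.1 a' hj'.1 haa
      have e1 := h1.1; have e2 := h2.1
      rw [ΦP_pos a h1a] at e1; rw [ΦP_pos a' h1a'] at e2
      exact prefix_fibre_disjoint eP ℓ hePinj preP hpreP a a' h1a h1a' ha ha' haa ξ e1 e2
  have cover : ∀ (SP₀ SQ₀ : Finset ℕ), (SP₀ = {0} ∨ SP₀ = Finset.Icc 1 (ℓ - 1)) → (SQ₀ = {0} ∨ SQ₀ = Finset.Icc 1 (m - 1)) →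
      ∀ σ : Finset ι, (SP₀ = Finset.Icc 1 (ℓ - 1) → eP 1 ∈ σ) → (SQ₀ = Finset.Icc 1 (m - 1) → eQ 1 ∈ σ) → N σ →
      ∃ j ∈ SP₀ ×ˢ SQ₀, fib j σ := by
    intro SP₀ SQ₀ hSP₀ hSQ₀ σ hP1 hQ1 hNσ
    rw [hN] at hNσ
    have exa : ∃ a ∈ SP₀, σ ∩ ΦP a = preP a := by
      rcases hSP₀ with hS | hS
      · exact ⟨0, by rw [hS]; exact Finset.mem_singleton_self 0, ΦP_zero σ⟩
      · obtain ⟨a, ha1, haℓ, hfa⟩ := prefix_fibre_cover eP ℓ P hPe preP hpreP σ (hP1 hS) hNσ.1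
        exact ⟨a, by rw [hS, Finset.mem_Icc]; omega, by rw [ΦP_pos a ha1]; exact hfa⟩
    have exc : ∃ c ∈ SQ₀, σ ∩ ΦQ c = preQ c := by
      rcases hSQ₀ with hS | hS
      · exact ⟨0, by rw [hS]; exact Finset.mem_singleton_self 0, ΦQ_zero σ⟩
      · obtain ⟨c, hc1, hcm, hfc⟩ := prefix_fibre_cover eQ m Q hQe preQ hpreQ σ (hQ1 hS) hNσ.2
        exact ⟨c, by rw [hS, Finset.mem_Icc]; omega, by rw [ΦQ_pos c hc1]; exact hfc⟩
    obtain ⟨a, haS, hfa⟩ := exa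
    obtain ⟨c, hcS, hfc⟩ := exc
    exact ⟨(a, c), Finset.mem_product.mpr ⟨haS, hcS⟩, by rw [hfibd]; exact ⟨hfa, hfc⟩⟩
  have key := two_fibre_systems_count E' (SP ×ˢ SQ) (SP' ×ˢ SQ') src₁ src₂ T₁ T₂ Jn fib land₁ land₂
    (fun j hj => (flow j.1 j.2 (memS SP ℓ hℓ hSP j.1 (Finset.mem_product.mp hj).1) (memS SQ m hm hSQ j.2 (Finset.mem_product.mp hj).2)).1)
    (fun j hj => (flow j.1 j.2 (memS SP' ℓ hℓ hSP' j.1 (Finset.mem_product.mp hj).1) (memS SQ' m hm hSQ' j.2 (Finset.mem_product.mp hj).2)).2)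
    (fun ξ hξ hs => by
      rw [hsrc₁] at hs
      exact cover SP SQ hSP hSQ ξ (fun h => cov₁P h ξ hξ (by rw [hN] at hs; exact hs)) (fun h => cov₁Q h ξ hξ (by rw [hN] at hs; exact hs)) hs.2.1)
    (fun ξ hξ hs => by
      rw [hsrc₂] at hs
      exact cover SP' SQ' hSP' hSQ' ξ (fun h => cov₂P h ξ hξ (by rw [hN] at hs; exact hs)) (fun h => cov₂Q h ξ hξ (by rw [hN] at hs; exact hs)) hs.2.1)
    (disj SP SQ hSP hSQ) (disj SP' SQ' hSP' hSQ')
    (fun j hj ξ hξ hf hl => by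
      obtain ⟨a, c⟩ := j
      have ha := memS SP ℓ hℓ hSP a (Finset.mem_product.mp hj).1
      have hc := memS SQ m hm hSQ c (Finset.mem_product.mp hj).2
      obtain ⟨hρE, p1, p2, p3, -, q1, q2, q3, -⟩ := partner a c ha hc ξ hf
      rw [hland₁] at hl
      obtain ⟨hv, hh, hk, hn⟩ := hl
      rw [hN] at hn
      exact transfer₁ a c ha hc ξ (ρ (a, c) ξ) hξ hρE p1 p2 p3 q1 q2 q3 hv hh hk hn.1 hn.2)
    (fun j hj ξ hξ hf hl => by
      obtain ⟨a, c⟩ := j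
      have ha := memS SP' ℓ hℓ hSP' a (Finset.mem_product.mp hj).1
      have hc := memS SQ' m hm hSQ' c (Finset.mem_product.mp hj).2
      obtain ⟨hρE, p1, p2, p3, -, q1, q2, q3, -⟩ := partner a c ha hc ξ hf
      rw [hland₂] at hl
      obtain ⟨hv, hh, hk, hn⟩ := hl
      rw [hN] at hn
      exact transfer₂ a c ha hc ξ (ρ (a, c) ξ) hξ hρE p1 p2 p3 q1 q2 q3 hv hh hk hn.1 hn.2)
    (fun ξ hξ j hj j' hj' hf hl hf' hl' => by
      obtain ⟨a, c⟩ := j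
      obtain ⟨a', c'⟩ := j'
      have ha := memS SP ℓ hℓ hSP a (Finset.mem_product.mp hj).1
      have hc := memS SQ m hm hSQ c (Finset.mem_product.mp hj).2
      have ha' := memS SP' ℓ hℓ hSP' a' (Finset.mem_product.mp hj').1
      have hc' := memS SQ' m hm hSQ' c' (Finset.mem_product.mp hj').2
      obtain ⟨-, -, -, -, nP, -, -, -, nQ⟩ := partner a c ha hc ξ hf
      obtain ⟨-, -, -, -, nP', -, -, -, nQ'⟩ := partner a' c' ha' hc' ξ hf'
      rw [hland₁] at hl
      rw [hland₂] at hl'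
      rw [hJn, hN]
      refine ⟨hl.1, ⟨?_, ?_⟩, hl.2.1, hl'.2.1⟩
      · rcases jP with h | h
        · exact nP (memIcc SP ℓ h a (Finset.mem_product.mp hj).1)
        · exact nP' (memIcc SP' ℓ h a' (Finset.mem_product.mp hj').1)
      · rcases jQ with h | h
        · exact nQ (memIcc SQ m h c (Finset.mem_product.mp hj).2)
        · exact nQ' (memIcc SQ' m h c' (Finset.mem_product.mp hj').2))
  have e1 : S₁ = (E'.powerset).filter (fun ξ => src₁ ξ) := by
    ext ξ; rw [hS₁, Finset.mem_filter, Finset.mem_powerset, hsrc₁, hN]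
  have e2 : S₂ = (E'.powerset).filter (fun ξ => src₂ ξ) := by
    ext ξ; rw [hS₂, Finset.mem_filter, Finset.mem_powerset, hsrc₂, hN]
  have e3 : TT = (E'.powerset).filter (fun ξ => T₁ ξ ∨ T₂ ξ) := by
    ext ξ; rw [hTT, Finset.mem_filter, Finset.mem_powerset]
  have e4 : JJ = (E'.powerset).filter (fun ξ => Jn ξ) := by
    ext ξ; rw [hJJ, Finset.mem_filter, Finset.mem_powerset, hJn, hN]
  rw [e1, e2, e3, e4]
  exact key

open Classical in
/-- **THEOREM BI, abstract form (prefix-frozen flows + chain lemma).**  Setting of the module docstring: two disjoint threads `P, Q`, increasing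
`Vp, hro, kro`, decreasing `hbo, kbo`, transfer hypotheses for both types, and the CHAIN hypotheses (a type-1 source and a type-2 source cannot both be
blue-starting-or-empty on `P`; likewise on `Q`).  Then `#src₁ + #src₂ ≤ #(T₁ ∨ T₂) + #joins`.  Proof = the three-way assignment of memo gen 45 §3.9 (c):
with `Bᵢ` = the threads on which type `i` has a blue-starting-or-empty source, `B₁ ∩ B₂ = ∅`; if `B₂ = ∅` type 1 freezes nothing and type 2 both
threads, if `B₁ = ∅` symmetrically, otherwise each type freezes the one thread outside its `Bᵢ` (two different threads); `boundary_systems_count`.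
[cite: KozmaNitzan2024, Questions 8–9 (§5.5 p. 36) (context); Harris 1960] -/
theorem boundary_prefix_flows_count (P Q : Finset ι) (hPQ : Disjoint P Q) (ℓ m : ℕ) (hℓ : 1 ≤ ℓ) (hm : 1 ≤ m) (eP eQ : ℕ → ι)
    (heP : ∀ j, 1 ≤ j → j ≤ ℓ → eP j ∈ P) (hePinj : ∀ i j, 1 ≤ i → i ≤ ℓ → 1 ≤ j → j ≤ ℓ → eP i = eP j → i = j)
    (hPe : ∀ x ∈ P, ∃ j, 1 ≤ j ∧ j ≤ ℓ ∧ eP j = x)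
    (heQ : ∀ j, 1 ≤ j → j ≤ m → eQ j ∈ Q) (heQinj : ∀ i j, 1 ≤ i → i ≤ m → 1 ≤ j → j ≤ m → eQ i = eQ j → i = j)
    (hQe : ∀ x ∈ Q, ∃ j, 1 ≤ j ∧ j ≤ m ∧ eQ j = x)
    (Vp hro kro hbo kbo T₁ T₂ : Finset ι → Prop)
    (V_mono : ∀ s t : Finset ι, s ⊆ t → Vp s → Vp t) (hro_mono : ∀ s t : Finset ι, s ⊆ t → hro s → hro t)
    (kro_mono : ∀ s t : Finset ι, s ⊆ t → kro s → kro t)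
    (hbo_anti : ∀ s t : Finset ι, s ⊆ t → hbo t → hbo s) (kbo_anti : ∀ s t : Finset ι, s ⊆ t → kbo t → kbo s)
    (transfer₁ : ∀ a c : ℕ, a < ℓ → c < m → ∀ ξ ρ : Finset ι, ξ ⊆ P ∪ Q → ρ ⊆ P ∪ Q →
      (∀ j, 1 ≤ j → j ≤ a → eP j ∈ ξ ∧ eP j ∈ ρ) → (1 ≤ a → eP (a + 1) ∉ ξ ∧ eP (a + 1) ∉ ρ) →
      (∀ j, 1 ≤ j → j ≤ ℓ → (a = 0 ∨ a + 2 ≤ j) → (eP j ∈ ρ ↔ eP j ∉ ξ)) →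
      (∀ j, 1 ≤ j → j ≤ c → eQ j ∈ ξ ∧ eQ j ∈ ρ) → (1 ≤ c → eQ (c + 1) ∉ ξ ∧ eQ (c + 1) ∉ ρ) →
      (∀ j, 1 ≤ j → j ≤ m → (c = 0 ∨ c + 2 ≤ j) → (eQ j ∈ ρ ↔ eQ j ∉ ξ)) →
      Vp ξ → hro ξ → kbo ρ → ¬ P ⊆ ρ → ¬ Q ⊆ ρ → T₁ ξ)
    (transfer₂ : ∀ a c : ℕ, a < ℓ → c < m → ∀ ξ ρ : Finset ι, ξ ⊆ P ∪ Q → ρ ⊆ P ∪ Q →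
      (∀ j, 1 ≤ j → j ≤ a → eP j ∈ ξ ∧ eP j ∈ ρ) → (1 ≤ a → eP (a + 1) ∉ ξ ∧ eP (a + 1) ∉ ρ) →
      (∀ j, 1 ≤ j → j ≤ ℓ → (a = 0 ∨ a + 2 ≤ j) → (eP j ∈ ρ ↔ eP j ∉ ξ)) →
      (∀ j, 1 ≤ j → j ≤ c → eQ j ∈ ξ ∧ eQ j ∈ ρ) → (1 ≤ c → eQ (c + 1) ∉ ξ ∧ eQ (c + 1) ∉ ρ) →
      (∀ j, 1 ≤ j → j ≤ m → (c = 0 ∨ c + 2 ≤ j) → (eQ j ∈ ρ ↔ eQ j ∉ ξ)) →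
      Vp ξ → kro ξ → hbo ρ → ¬ P ⊆ ρ → ¬ Q ⊆ ρ → T₂ ξ)
    (chainP : ∀ σ₁ σ₂ : Finset ι, σ₁ ⊆ P ∪ Q → σ₂ ⊆ P ∪ Q →
      (Vp σ₁ ∧ (¬ P ⊆ σ₁ ∧ ¬ Q ⊆ σ₁) ∧ hro σ₁ ∧ kbo σ₁) → (Vp σ₂ ∧ (¬ P ⊆ σ₂ ∧ ¬ Q ⊆ σ₂) ∧ kro σ₂ ∧ hbo σ₂) →
      eP 1 ∉ σ₁ → eP 1 ∉ σ₂ → False)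
    (chainQ : ∀ σ₁ σ₂ : Finset ι, σ₁ ⊆ P ∪ Q → σ₂ ⊆ P ∪ Q →
      (Vp σ₁ ∧ (¬ P ⊆ σ₁ ∧ ¬ Q ⊆ σ₁) ∧ hro σ₁ ∧ kbo σ₁) → (Vp σ₂ ∧ (¬ P ⊆ σ₂ ∧ ¬ Q ⊆ σ₂) ∧ kro σ₂ ∧ hbo σ₂) →
      eQ 1 ∉ σ₁ → eQ 1 ∉ σ₂ → False)
    (S₁ S₂ TT JJ : Finset (Finset ι))
    (hS₁ : ∀ ξ, ξ ∈ S₁ ↔ ξ ⊆ P ∪ Q ∧ (Vp ξ ∧ (¬ P ⊆ ξ ∧ ¬ Q ⊆ ξ) ∧ hro ξ ∧ kbo ξ))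
    (hS₂ : ∀ ξ, ξ ∈ S₂ ↔ ξ ⊆ P ∪ Q ∧ (Vp ξ ∧ (¬ P ⊆ ξ ∧ ¬ Q ⊆ ξ) ∧ kro ξ ∧ hbo ξ))
    (hTT : ∀ ξ, ξ ∈ TT ↔ ξ ⊆ P ∪ Q ∧ (T₁ ξ ∨ T₂ ξ))
    (hJJ : ∀ ξ, ξ ∈ JJ ↔ ξ ⊆ P ∪ Q ∧ (Vp ξ ∧ (¬ P ⊆ ξ ∧ ¬ Q ⊆ ξ) ∧ hro ξ ∧ kro ξ)) :
    S₁.card + S₂.card ≤ TT.card + JJ.card := by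
  have main := fun (SP SQ SP' SQ' : Finset ℕ) hSP hSQ hSP' hSQ' c₁P c₁Q c₂P c₂Q jP jQ =>
    boundary_systems_count P Q hPQ ℓ m hℓ hm eP eQ heP hePinj hPe heQ heQinj hQe Vp hro kro hbo kbo T₁ T₂ V_mono hro_mono kro_mono
      hbo_anti kbo_anti transfer₁ transfer₂ SP SQ SP' SQ' hSP hSQ hSP' hSQ' c₁P c₁Q c₂P c₂Q jP jQ S₁ S₂ TT JJ hS₁ hS₂ hTT hJJ
  have ne0 : ∀ n : ℕ, ({0} : Finset ℕ) ≠ Finset.Icc 1 n := by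
    intro n h
    have h0 : (0 : ℕ) ∈ Finset.Icc 1 n := by rw [← h]; exact Finset.mem_singleton_self 0
    rw [Finset.mem_Icc] at h0; omega
  -- the blue-starting-or-empty source indicators `P ∈ Bᵢ`, `Q ∈ Bᵢ`
  by_cases hB2P : ∃ σ, σ ⊆ P ∪ Q ∧ (Vp σ ∧ (¬ P ⊆ σ ∧ ¬ Q ⊆ σ) ∧ kro σ ∧ hbo σ) ∧ eP 1 ∉ σ
    <;> by_cases hB2Q : ∃ σ, σ ⊆ P ∪ Q ∧ (Vp σ ∧ (¬ P ⊆ σ ∧ ¬ Q ⊆ σ) ∧ kro σ ∧ hbo σ) ∧ eQ 1 ∉ σ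
    <;> by_cases hB1P : ∃ σ, σ ⊆ P ∪ Q ∧ (Vp σ ∧ (¬ P ⊆ σ ∧ ¬ Q ⊆ σ) ∧ hro σ ∧ kbo σ) ∧ eP 1 ∉ σ
    <;> by_cases hB1Q : ∃ σ, σ ⊆ P ∪ Q ∧ (Vp σ ∧ (¬ P ⊆ σ ∧ ¬ Q ⊆ σ) ∧ hro σ ∧ kbo σ) ∧ eQ 1 ∉ σ
  -- sixteen Boolean cases; each is settled by one of the four admissible system pairs or is contradictory by the chain hypotheses
  all_goals first
    -- B₂ = ∅ : type 1 plain, type 2 double freeze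
    | exact main {0} {0} (Finset.Icc 1 (ℓ - 1)) (Finset.Icc 1 (m - 1)) (Or.inl rfl) (Or.inl rfl) (Or.inr rfl) (Or.inr rfl)
        (fun h => absurd h (ne0 _)) (fun h => absurd h (ne0 _))
        (fun _ σ hσ hs => by by_contra hn; exact hB2P ⟨σ, hσ, hs, hn⟩) (fun _ σ hσ hs => by by_contra hn; exact hB2Q ⟨σ, hσ, hs, hn⟩)
        (Or.inr rfl) (Or.inr rfl)
    -- B₁ = ∅ : type 1 double freeze, type 2 plain
    | exact main (Finset.Icc 1 (ℓ - 1)) (Finset.Icc 1 (m - 1)) {0} {0} (Or.inr rfl) (Or.inr rfl) (Or.inl rfl) (Or.inl rfl)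
        (fun _ σ hσ hs => by by_contra hn; exact hB1P ⟨σ, hσ, hs, hn⟩) (fun _ σ hσ hs => by by_contra hn; exact hB1Q ⟨σ, hσ, hs, hn⟩)
        (fun h => absurd h (ne0 _)) (fun h => absurd h (ne0 _))
        (Or.inl rfl) (Or.inl rfl)
    -- B₁ = {P}, B₂ = {Q} : type 1 freezes Q, type 2 freezes P
    | exact main {0} (Finset.Icc 1 (m - 1)) (Finset.Icc 1 (ℓ - 1)) {0} (Or.inl rfl) (Or.inr rfl) (Or.inr rfl) (Or.inl rfl)
        (fun h => absurd h (ne0 _)) (fun _ σ hσ hs => by by_contra hn; exact hB1Q ⟨σ, hσ, hs, hn⟩)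
        (fun _ σ hσ hs => by by_contra hn; exact hB2P ⟨σ, hσ, hs, hn⟩) (fun h => absurd h (ne0 _))
        (Or.inr rfl) (Or.inl rfl)
    -- B₁ = {Q}, B₂ = {P} : type 1 freezes P, type 2 freezes Q
    | exact main (Finset.Icc 1 (ℓ - 1)) {0} {0} (Finset.Icc 1 (m - 1)) (Or.inr rfl) (Or.inl rfl) (Or.inl rfl) (Or.inr rfl)
        (fun _ σ hσ hs => by by_contra hn; exact hB1P ⟨σ, hσ, hs, hn⟩) (fun h => absurd h (ne0 _))
        (fun h => absurd h (ne0 _)) (fun _ σ hσ hs => by by_contra hn; exact hB2Q ⟨σ, hσ, hs, hn⟩)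
        (Or.inl rfl) (Or.inr rfl)
    | exact False.elim (by
        obtain ⟨σ₁, h₁, s₁, n₁⟩ := hB1P
        obtain ⟨σ₂, h₂, s₂, n₂⟩ := hB2P
        exact chainP σ₁ σ₂ h₁ h₂ s₁ s₂ n₁ n₂)
    | exact False.elim (by
        obtain ⟨σ₁, h₁, s₁, n₁⟩ := hB1Q
        obtain ⟨σ₂, h₂, s₂, n₂⟩ := hB2Q
        exact chainQ σ₁ σ₂ h₁ h₂ s₁ s₂ n₁ n₂)

end Coefficientwise

end Summit.CriticalPhenomena.PercolationContinuityZ3.Theorems
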